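import Summits.ResolutionOfSingularities.ResolutionOfSingularities.Theorems.RadicialJungCleanModelsSufficeReduction

/-!
# Crux `CleanModelsSuffice` (stmt-ResolutionOfSingularities-15883), line `Sketch` — the RIDER form, proved modulo Kato

Route `ResolutionOfSingularities/RadicialJung`. The crux `CleanModelsSuffice` is `∀ p prime, PIAlt_p → CleanModels_p →
ResolutionInChar p`, where `CleanModels_p` (crux stmt-ResolutionOfSingularities-15917, an open problem) asks for proper
birational regular models with POINTWISE log-clean presentations. The line `Sketch` closes the crux modulo Kato 1994
(10.4), (4.1) and the exceptionalisation game (`cleanModelsSuffice_of_kato_of_game`). This file records the companion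
fact behind the lead's rider recommendation (`Cruxes/CleanModelsSuffice` evidence `RIDER.md`): if `CleanModels_p` is
stated with PAIRWISE ADAPTED data (`CleanModelsR_p`: the clean presentations come with boundary sections on
neighbourhoods, a joint system-of-parameters clause and an overlap clause with exponents proportional modulo `p` —
verbatim the `hR` hypothesis of `stub_charts`), then NO game is needed:

* `resolutionInChar_of_kato_of_adaptedModels : Kato (10.4) → Kato (4.1) → PIAlt_p → CleanModelsR_p → ResolutionInChar p`.

Proof: `hasResolution_normalizationIn_of_adaptedModel` (charts + atlas + Kato + birational descent) feeds the degree-`p`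
frame `picoverAt_of_degPAt` and `palterationThesisAt_iff_resolutionInChar`.
-/

noncomputable section

set_option linter.dupNamespace false -- mandated namespace of this single-conjunct summit

open CategoryTheory CategoryTheory.Limits AlgebraicGeometry TopologicalSpace
open Literature.AlgebraicGeometry.Resolution Literature.AlgebraicGeometry.Motives
open Summit.ResolutionOfSingularities.ResolutionOfSingularities.Theorems.Picover

namespace Summit.ResolutionOfSingularities.ResolutionOfSingularities.Theorems.RadicialJung.CleanModelsSuffice

/-- **The rider form of the crux, modulo Kato.** For a prime `p`: if every integral separated finite-type scheme over a
field of characteristic `p` has a regular purely-inseparable alteration (`PIAlt_p`, the first hypothesis of the crux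
verbatim) and every degree-`p` purely inseparable extension of the function field of a regular such scheme has a proper
birational regular model with PAIRWISE ADAPTED log-clean data (`CleanModelsR_p`), then — granted Kato 1994 (10.4)
`hK` and (4.1) `hK4` — resolution of singularities holds in characteristic `p`. [folklore] -/
theorem resolutionInChar_of_kato_of_adaptedModels
    (hK : Kato1994_logRegularScheme_hasResolution.{0})
    (hK4 : Kato1994_logRegularLocal_isIntegrallyClosed.{0})
    (p : ℕ) (hp : p.Prime)
    (hPI : ∀ (k : Type) [Field k] [CharP k p] (X : Scheme.{0}) (f : X ⟶ Spec (.of k)),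
      IsSeparated f → LocallyOfFiniteType f → QuasiCompact f → IsIntegral X →
      ∃ (X' : Scheme.{0}) (g : X' ⟶ X), IsProper g ∧ IsIntegral X' ∧ Scheme.IsRegular X' ∧
        Function.Surjective g.base ∧ ∃ U : X.Opens, Dense (U : Set X) ∧
          IsFinite (g ∣_ U) ∧ UniversallyInjective (g ∣_ U))
    (hCMR : ∀ (k : Type) [Field k] [CharP k p] (W : Scheme.{0}) [IsIntegral W] (f : W ⟶ Spec (.of k))
      (L : Type) [Field L] [Algebra W.functionField L],
      IsSeparated f → LocallyOfFiniteType f → QuasiCompact f → Scheme.IsRegular W →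
      IsPurelyInseparable W.functionField L → Module.finrank W.functionField L = p →
      ∃ (V : Scheme.{0}) (π : V ⟶ W) (_ : IsIntegral V) (_ : IsDominant π),
        IsProper π ∧ IsBirational π ∧ Scheme.IsRegular V ∧

        ∃ (y : V → L) (g : V → W.functionField) (d r m : V → ℕ) (hrd : ∀ v, r v ≤ d v)
          (hmr : ∀ v, m v ≤ r v) (t : ∀ v : V, Fin (d v) → V.presheaf.stalk v) (a : ∀ v : V, Fin (m v) → ℕ)
          (U : V → V.Opens) (hU : ∀ v, v ∈ U v) (s : ∀ v : V, Fin (r v) → Γ(V, U v)),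
          (∀ v : V, y v ∉ Set.range (algebraMap W.functionField L) ∧
            algebraMap W.functionField L (g v) = y v ^ p ∧
            Ideal.span (Set.range (t v)) = IsLocalRing.maximalIdeal (V.presheaf.stalk v) ∧
            ringKrullDim (V.presheaf.stalk v) = (d v : WithBot ℕ∞) ∧
            (∀ i : Fin (r v), V.presheaf.germ (U v) v (hU v) (s v i) = t v (Fin.castLE (hrd v) i)) ∧
            (∀ i : Fin (m v), ¬ p ∣ a v i) ∧
            ((0 < m v ∧ RatFn.functionFieldMap π (g v) = ∏ i : Fin (m v),
                (algebraMap (V.presheaf.stalk v) V.functionField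
                  (t v (Fin.castLE ((hmr v).trans (hrd v)) i))) ^ (a v i)) ∨
              (m v = 0 ∧ ∃ u₀ : V.presheaf.stalk v, IsUnit u₀ ∧
                RatFn.functionFieldMap π (g v) = algebraMap (V.presheaf.stalk v) V.functionField u₀ ∧
                ((∀ x : V.presheaf.stalk v, u₀ - x ^ p ∉ IsLocalRing.maximalIdeal (V.presheaf.stalk v)) ∨
                  (∃ x : V.presheaf.stalk v, u₀ - x ^ p ∈ IsLocalRing.maximalIdeal (V.presheaf.stalk v) ∧
                    u₀ - x ^ p ∉ IsLocalRing.maximalIdeal (V.presheaf.stalk v) ^ 2 ⊔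
                      Ideal.span (Set.range fun i : Fin (r v) => t v (Fin.castLE (hrd v) i))))))) ∧
          (∀ (v w : V) (hw : w ∈ U v), ∃ (dw : ℕ) (tw : Fin dw → V.presheaf.stalk w) (ι : Fin (r v) → Fin dw),
            Ideal.span (Set.range tw) = IsLocalRing.maximalIdeal (V.presheaf.stalk w) ∧
            ringKrullDim (V.presheaf.stalk w) = (dw : WithBot ℕ∞) ∧
            (∀ i : Fin (r v), V.presheaf.germ (U v) w hw (s v i) ∈ IsLocalRing.maximalIdeal (V.presheaf.stalk w) →
              tw (ι i) = V.presheaf.germ (U v) w hw (s v i)) ∧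
            (∀ i j : Fin (r v), V.presheaf.germ (U v) w hw (s v i) ∈ IsLocalRing.maximalIdeal (V.presheaf.stalk w) →
              V.presheaf.germ (U v) w hw (s v j) ∈ IsLocalRing.maximalIdeal (V.presheaf.stalk w) → ι i = ι j → i = j)) ∧
          (∀ (v v' w : V) (hw : w ∈ U v) (hw' : w ∈ U v'), ∃ μ : ℕ, ¬ p ∣ μ ∧ ∀ i : Fin (r v),
            V.presheaf.germ (U v) w hw (s v i) ∈ IsLocalRing.maximalIdeal (V.presheaf.stalk w) →
            ∃ i' : Fin (r v'), Associated (V.presheaf.germ (U v) w hw (s v i))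
                (V.presheaf.germ (U v') w hw' (s v' i')) ∧
              ((i : ℕ) < m v ↔ (i' : ℕ) < m v') ∧
              (∀ (hi : (i : ℕ) < m v) (hi' : (i' : ℕ) < m v'), a v' ⟨i', hi'⟩ ≡ μ * a v ⟨i, hi⟩ [MOD p]))) :
    ResolutionInChar.{0} p := by
  have hDegP : ∀ (k : Type) [Field k] [CharP k p] (W : Scheme.{0}) [IsIntegral W]
      (f : W ⟶ Spec (.of k)) (L : Type) [Field L] [Algebra W.functionField L],
      IsSeparated f → LocallyOfFiniteType f → QuasiCompact f → Scheme.IsRegular W →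
      IsPurelyInseparable W.functionField L → Module.finrank W.functionField L = p →
      Scheme.HasResolution (normalizationIn W L) := by
    intro k _ _ W _ f L _ _ hs hl hq hr hpi hd
    haveI := hs; haveI := hl; haveI := hq; haveI := hpi
    obtain ⟨V, π, hVi, hdom, hprop, hbir, hVreg, hRv⟩ := hCMR k W f L hs hl hq hr hpi hd
    haveI := hVi; haveI := hdom; haveI := hprop
    exact hasResolution_normalizationIn_of_adaptedModel hK hK4 p hp k W f L hd V π hbir hVreg hRv
  exact (palterationThesisAt_iff_resolutionInChar p hp).mp ⟨hPI, picoverAt_of_degPAt p hp hDegP⟩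

end Summit.ResolutionOfSingularities.ResolutionOfSingularities.Theorems.RadicialJung.CleanModelsSuffice

end
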